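import Literature.Combinatorics.SimpleGraph.GridFormulaGadgets
import Literature.Combinatorics.SimpleGraph.HamiltonianTableCensus
import HarnessLib

/-!
# The grid graph of a formula, III: the number of Hamiltonian paths is `2 · #SAT`

The count of the grid-native `#3SAT ≤ #HamPath` construction (Liśkiewicz–Ogihara–Toda 2003,
Lemma 4 / Theorem 7; tree fact `Literature.Barriers.CriticalPhenomena.GridSAW.LOT2003_lemma4_gadgets`):
for a CNF `ψ` whose clauses have one or three literals, the graph obtained from the chain of cells
`cellsOf ψ` (`GridFormulaCells.lean`) by substituting the gadget family `family ψ`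
(`GridFormulaGadgets.lean`) has exactly `2 · #SAT(ψ)` Hamiltonian paths from `conn 0` to `lastQ`.
The proof assembles: the table-census corollary of the substitution theorem
(`HamiltonianTableCensus.lean`), the decomposition of Hamiltonian paths of the chain into tuples of
cell traversals (`CellChain.lean`), and a Boolean analysis of the resulting constraint system
(row wires carry the variables, crossover tiles transmit both wires, the landing parity rule makes the
clause-row terminal carry the literal, OR-gadgets test the clauses; the doubling cell is free).

* `T ψ g`, `coverCount_eq_T`, **`hamCount_graphOf_eq_card`** — reduction to index vectors;
* `ub`, `uses_gs_iff` — used slots as bits of the cells' usage tables;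
* `stateOf`, …, **`hamCount_graphOf_eq_two_mul_numSat`** — the count.

## References

* M. Liśkiewicz, M. Ogihara, S. Toda, TCS 304 (2003) 129–156, §3 (proof of Lemma 4: "each
  Hamiltonian path of `G` corresponds to a satisfying assignment").
* M. R. Garey, D. S. Johnson, *Computers and Intractability*, Freeman 1979, §3.2.2.
-/

namespace Literature.Combinatorics.SimpleGraph

namespace GridFormula

open GridCell GridCell.CellTy Literature.Computability.Complexity Slot Finset

variable (ψ : CNF ℕ)

/-! ### The substituted graph and the tables -/

/-- **The graph of `ψ`**: the chain of cells with all gadgets substituted. [folklore] -/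
def graphOf : _root_.SimpleGraph ℕ :=
  GadgetFamily.graphUpTo (GridCell.chainG (cellsOf ψ)) (chainVerts (cellsOf ψ)) (family ψ) (ngadgets ψ)

/-- The vertex set of the graph of `ψ`. [folklore] -/
def vertsOf : Finset ℕ :=
  GadgetFamily.vertsUpTo (chainVerts (cellsOf ψ)) (family ψ) (ngadgets ψ)

/-- **The table of gadget `g`** as a set of slot sets: the subsets of its slots in its Boolean table,
or `{∅}` for an absent gadget. [folklore] -/
def T (g : ℕ) : Finset (Finset (ℕ × ℕ)) :=
  if (place ψ g).isSome then ((family ψ).S g).powerset.filter fun U => tabOf ψ g U = true else {∅}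

/-- **The census of every gadget of the family is its table.** [folklore] -/
theorem coverCount_eq_T (g : ℕ) (U : Finset (ℕ × ℕ)) (hU : U ⊆ (family ψ).S g) :
    coverCount ((family ψ).GX g) ((family ψ).VX g) U = if U ∈ T ψ g then 1 else 0 := by
  unfold T
  cases hP : place ψ g with
  | none =>
    have hS := family_S_none ψ hP
    rw [hS, subset_empty] at hU
    subst hU
    rw [coverCount_family_none ψ hP]
    simp
  | some P =>
    rw [coverCount_family_some ψ hP U hU]
    simp only [Option.isSome_some, ↓reduceIte, mem_filter, mem_powerset, hU, true_and]

/-- **Reduction to index vectors**: the number of Hamiltonian `s`–`t` paths of the graph of `ψ` is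
the number of valid traversal-index vectors of the chain whose used slots match all tables.
[folklore] -/
theorem hamCount_graphOf_eq_card :
    hamCount (graphOf ψ) (vertsOf ψ) (conn 0) (lastQ (cellsOf ψ)) =
      (univ.filter fun σ : Fin (cellsOf ψ).length → Fin 4 => ValidIdx (cellsOf ψ) σ ∧
        ∀ g < ngadgets ψ, ((family ψ).S g).filter (fun e => Uses (pathOfN (cellsOf ψ) (extN σ)) e) ∈ T ψ g).card := by
  classical
  rw [graphOf, vertsOf, (valid ψ (ngadgets ψ)).hamCount_graphUpTo_eq_ncard (conn_zero_mem_chainVerts (cellsOf_ne_nil ψ))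
    (lastQ_mem_chainVerts (cellsOf_ne_nil ψ)) (T ψ) fun g _ U hU => coverCount_eq_T ψ g U hU,
    ncard_isHamPathOn_eq_card (cellsOf_ne_nil ψ)]

/-! ### Used slots as bits -/

/-- **The usage bit** of the local slot `e` of cell `k` under the index vector `σ`. [folklore] -/
def ub (σ : Fin (cellsOf ψ).length → Fin 4) (k : ℕ) (e : Fin 16 × Fin 16) : Bool :=
  usesB ((cellTyAt ψ k).travs.getD (extN σ k) []) e

variable {ψ} in
/-- The canonical path uses a global slot iff the usage bit is set. [folklore] -/
theorem uses_gs_iff {σ : Fin (cellsOf ψ).length → Fin 4} (hσ : ValidIdx (cellsOf ψ) σ) {k : ℕ} (hk : k < ncells ψ)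
    (e : Fin 16 × Fin 16) : Uses (pathOfN (cellsOf ψ) (extN σ)) (gs k e) ↔ ub ψ σ k e = true := by
  have hk' : k < (cellsOf ψ).length := by rwa [length_cellsOf]
  rw [gs, uses_pathOfN_vtx_iff (cellsOf ψ) (extN_lt hσ) hk' e.1 e.2, cellTy_cellsOf ψ hk, ub, usesB_eq_true_iff]

/-- The placed slots of an XOR-chord. [folklore] -/
theorem xorAt?_S {g k₁ k₂ : ℕ} {e₁ e₂ : Fin 16 × Fin 16} {P : RailPlacement} (h : xorAt? ψ g k₁ e₁ k₂ e₂ = some P) :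
    P.S = {gs k₁ e₁, gs k₂ e₂} ∧ gs k₁ e₁ ≠ gs k₂ e₂ := by
  unfold xorAt? at h
  split_ifs at h with hg
  simp only [Option.some.injEq] at h
  subst h
  refine ⟨?_, fun heq => hg.2.2.1 ((gs_inj).1 heq).1⟩
  ext e
  rw [RailPlacement.mem_S_iff]
  simp only [mem_insert, mem_singleton]
  constructor
  · rintro ⟨r, rfl⟩
    have : ∀ s : Fin 2, s = 0 ∨ s = 1 := by decide
    rcases this r with rfl | rfl
    exacts [Or.inl rfl, Or.inr rfl]
  · rintro (rfl | rfl)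
    exacts [⟨0, rfl⟩, ⟨1, by simp⟩]

/-- The placed slot of a one-input OR-gadget. [folklore] -/
theorem or1At?_S {g k : ℕ} {P : RailPlacement} (h : or1At? ψ g k = some P) : P.S = {gs k bS0} := by
  unfold or1At? at h
  split_ifs at h with hg
  simp only [Option.some.injEq] at h
  subst h
  ext e
  rw [RailPlacement.mem_S_iff]
  simp

/-- The placed slots of a three-input OR-gadget. [folklore] -/
theorem or3At?_S {g k : ℕ} {P : RailPlacement} (h : or3At? ψ g k = some P) :
    P.S = {gs k bS0, gs (k + 1) bS0, gs (k + 2) bS0} := by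
  unfold or3At? at h
  split_ifs at h with hg
  simp only [Option.some.injEq] at h
  subst h
  ext e
  rw [RailPlacement.mem_S_iff]
  simp only [mem_insert, mem_singleton]
  constructor
  · rintro ⟨r, rfl⟩
    have : ∀ s : Fin 3, s = 0 ∨ s = 1 ∨ s = 2 := by decide
    rcases this r with rfl | rfl | rfl
    · exact Or.inl (by simp)
    · exact Or.inr (Or.inl rfl)
    · exact Or.inr (Or.inr rfl)
  · rintro (rfl | rfl | rfl)
    exacts [⟨0, by simp⟩, ⟨1, rfl⟩, ⟨2, rfl⟩]

/-- `tabOf` on an XOR-chord index. [folklore] -/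
theorem tabOf_of_xor {g : ℕ} {k₁ k₂ : ℕ} {e₁ e₂ : Fin 16 × Fin 16} (h : gad ψ g = some (.xor k₁ e₁ k₂ e₂)) :
    tabOf ψ g = xorTab := by
  unfold tabOf
  unfold gad at h
  split_ifs at h with h1 h2
  · rw [if_pos (by omega)]
  · rw [if_pos (by omega)]
  · unfold clauseGad at h; split_ifs at h <;> simp at h

/-- `tabOf` on an OR-gadget index. [folklore] -/
theorem tabOf_of_or {g k : ℕ} (h : gad ψ g = some (.or1 k) ∨ gad ψ g = some (.or3 k)) : tabOf ψ g = orTab := by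
  unfold tabOf
  unfold gad at h
  split_ifs at h with h1 h2
  · unfold tileGad at h; split_ifs at h <;> simp at h
  · simp at h
  · rw [if_neg (by omega)]

/-- **The table condition of an XOR-chord**: exactly one of its two slots is used. [folklore] -/
theorem cond_xor_iff {g k₁ k₂ : ℕ} {e₁ e₂ : Fin 16 × Fin 16} {P : RailPlacement} (hs : gad ψ g = some (.xor k₁ e₁ k₂ e₂))
    (hP : xorAt? ψ g k₁ e₁ k₂ e₂ = some P) (l : List ℕ) :
    ((family ψ).S g).filter (fun e => Uses l e) ∈ T ψ g ↔ (Uses l (gs k₁ e₁) ↔ ¬ Uses l (gs k₂ e₂)) := by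
  have hplace : place ψ g = some P := by rw [place, hs, Option.bind_some]; exact hP
  obtain ⟨hS, hne⟩ := xorAt?_S ψ hP
  rw [T, if_pos (by rw [hplace]; rfl), mem_filter, mem_powerset, tabOf_of_xor ψ hs, family_S, hplace]
  simp only [Option.elim, hS, filter_subset, true_and, xorTab, decide_eq_true_eq]
  rw [filter_insert, filter_singleton]
  by_cases h1 : Uses l (gs k₁ e₁) <;> by_cases h2 : Uses l (gs k₂ e₂) <;> simp [h1, h2, hne, card_insert_of_notMem]

/-- **The table condition of a one-input OR-gadget**: its slot is used. [folklore] -/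
theorem cond_or1_iff {g k : ℕ} {P : RailPlacement} (hs : gad ψ g = some (.or1 k)) (hP : or1At? ψ g k = some P) (l : List ℕ) :
    ((family ψ).S g).filter (fun e => Uses l e) ∈ T ψ g ↔ Uses l (gs k bS0) := by
  have hplace : place ψ g = some P := by rw [place, hs, Option.bind_some]; exact hP
  have hS := or1At?_S ψ hP
  rw [T, if_pos (by rw [hplace]; rfl), mem_filter, mem_powerset, tabOf_of_or ψ (Or.inl hs), family_S, hplace]
  simp only [Option.elim, hS, orTab, Bool.not_eq_true', decide_eq_false_iff_not, filter_singleton]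
  by_cases h : Uses l (gs k bS0) <;> simp [h]

/-- **The table condition of a three-input OR-gadget**: one of its slots is used. [folklore] -/
theorem cond_or3_iff {g k : ℕ} {P : RailPlacement} (hs : gad ψ g = some (.or3 k)) (hP : or3At? ψ g k = some P) (l : List ℕ) :
    ((family ψ).S g).filter (fun e => Uses l e) ∈ T ψ g ↔
      Uses l (gs k bS0) ∨ Uses l (gs (k + 1) bS0) ∨ Uses l (gs (k + 2) bS0) := by
  have hplace : place ψ g = some P := by rw [place, hs, Option.bind_some]; exact hP
  have hS := or3At?_S ψ hP
  rw [T, if_pos (by rw [hplace]; rfl), mem_filter, mem_powerset, tabOf_of_or ψ (Or.inr hs), family_S, hplace]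
  simp only [Option.elim, hS, filter_subset, true_and, orTab, Bool.not_eq_true', decide_eq_false_iff_not, ← ne_eq,
    ← nonempty_iff_ne_empty, filter_nonempty_iff, mem_insert, mem_singleton]
  constructor
  · rintro ⟨e, (rfl | rfl | rfl), he⟩
    exacts [Or.inl he, Or.inr (Or.inl he), Or.inr (Or.inr he)]
  · rintro (h | h | h)
    exacts [⟨_, Or.inl rfl, h⟩, ⟨_, Or.inr (Or.inl rfl), h⟩, ⟨_, Or.inr (Or.inr rfl), h⟩]

/-! ### The intended states -/

/-- The state of a one-bit cell carrying the bit `b` (traversal `0` iff `b`). [folklore] -/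
def beadState (b : Bool) : Fin 4 := if b then 0 else 1

/-- **The states of the three cells of a crossing** carrying the row bit `r` and receiving the column
usage bit `w` from above (found by solving the six chord equations; unique). [folklore] -/
def crossStates (r w : Bool) : Fin 4 × Fin 4 × Fin 4 :=
  match r, w with
  | false, false => (0, 1, 2)
  | false, true => (1, 2, 0)
  | true, false => (3, 3, 3)
  | true, true => (2, 0, 1)

/-- **The column usage bit** of column `j` leaving row `i ≥ rowOf`: the value of the column's variable,
complemented an extra time for the tap and once per crossing. [folklore] -/
def colBit (xr : ℕ → Bool) (i j : ℕ) : Bool :=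
  xor (xr (rowOf ψ (varOf ψ j))) (decide ((i - rowOf ψ (varOf ψ j)) % 2 = 0))

/-- **The value of the literal of column `j`** under the row assignment `xr`. [folklore] -/
def litVal (xr : ℕ → Bool) (j : ℕ) : Bool := xr (rowOf ψ (varOf ψ j)) == polOf ψ j

/-- **The intended state of cell `k`** under the row assignment `xr` and the doubling bit `d`.
[folklore] -/
def stateAt (xr : ℕ → Bool) (d : Bool) (k : ℕ) : Fin 4 :=
  if k = 0 then beadState d
  else if k < 1 + 3 * (V ψ * N ψ) then
    (if tileTy ψ ((k - 1) / 3 / N ψ) ((k - 1) / 3 % N ψ) = .cross then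
      (if (k - 1) % 3 = 0 then (crossStates (xr ((k - 1) / 3 / N ψ)) (colBit ψ xr ((k - 1) / 3 / N ψ - 1) ((k - 1) / 3 % N ψ))).1
        else if (k - 1) % 3 = 1 then (crossStates (xr ((k - 1) / 3 / N ψ)) (colBit ψ xr ((k - 1) / 3 / N ψ - 1) ((k - 1) / 3 % N ψ))).2.1
        else (crossStates (xr ((k - 1) / 3 / N ψ)) (colBit ψ xr ((k - 1) / 3 / N ψ - 1) ((k - 1) / 3 % N ψ))).2.2)
    else beadState (xr ((k - 1) / 3 / N ψ)))
  else beadState (litVal ψ xr (k - (1 + 3 * (V ψ * N ψ))))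

/-- `stateAt` on a tile cell. [folklore] -/
theorem stateAt_tileCell (xr : ℕ → Bool) (d : Bool) {i j c : ℕ} (hi : i < V ψ) (hj : j < N ψ) (hc : c < 3) :
    stateAt ψ xr d (tileCell ψ i j c) =
      if tileTy ψ i j = .cross then
        (if c = 0 then (crossStates (xr i) (colBit ψ xr (i - 1) j)).1
          else if c = 1 then (crossStates (xr i) (colBit ψ xr (i - 1) j)).2.1
          else (crossStates (xr i) (colBit ψ xr (i - 1) j)).2.2)
      else beadState (xr i) := by
  obtain ⟨h1, h2, h3⟩ := tileCell_arith ψ (i := i) hj hc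
  unfold stateAt
  rw [if_neg (tileCell_pos ψ i j c).ne', if_pos (tileCell_lt ψ hi hj hc), h1, h2, h3]

/-- `stateAt` on a clause-row terminal. [folklore] -/
theorem stateAt_clauseBead (xr : ℕ → Bool) (d : Bool) (j : ℕ) :
    stateAt ψ xr d (clauseBead ψ j) = beadState (litVal ψ xr j) := by
  unfold stateAt clauseBead
  rw [if_neg (by omega), if_neg (by omega), show 1 + 3 * (V ψ * N ψ) + j - (1 + 3 * (V ψ * N ψ)) = j by omega]

/-- `stateAt 0` is the doubling bit. [folklore] -/
theorem stateAt_zero (xr : ℕ → Bool) (d : Bool) : stateAt ψ xr d 0 = beadState d := by simp [stateAt]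

/-- **The intended index vector.** [folklore] -/
def stateOf (xr : ℕ → Bool) (d : Bool) : Fin (cellsOf ψ).length → Fin 4 := fun k => stateAt ψ xr d k.val

/-- The extension of the intended vector is `stateAt` below the number of cells. [folklore] -/
theorem extN_stateOf (xr : ℕ → Bool) (d : Bool) {k : ℕ} (hk : k < ncells ψ) :
    extN (stateOf ψ xr d) k = (stateAt ψ xr d k).val := by
  have hk' : k < (cellsOf ψ).length := by rwa [length_cellsOf]
  rw [extN, dif_pos hk']
  rfl

/-! ### Local computations (by kernel evaluation of the usage tables) -/

/-- One-bit cell states are `0` or `1`. [folklore] -/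
theorem beadState_lt (b : Bool) : (beadState b).val < 2 := by cases b <;> decide

/-- **The usage bits of a one-bit cell in state `beadState b`.** [folklore] -/
theorem usesB_beadState (b : Bool) :
    usesB (bead.travs.getD (beadState b).val []) bS0 = b ∧ usesB (bead.travs.getD (beadState b).val []) bN3 = b ∧
    usesB (bead.travs.getD (beadState b).val []) bN6 = !b ∧ usesB (bead.travs.getD (beadState b).val []) bS1 = !b ∧
    usesB (bead.travs.getD (beadState b).val []) bN0 = !b := by
  rw [travs_bead]; cases b <;> decide

/-- A valid one-bit state is determined by any of its bits. [folklore] -/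
theorem bead_state_eq {s : ℕ} (hs : s < 2) (e : Fin 16 × Fin 16) (he : e = bS0 ∨ e = bN3 ∨ e = bN6 ∨ e = bS1 ∨ e = bN0) (b : Bool)
    (h : usesB (bead.travs.getD s []) e = usesB (bead.travs.getD (beadState b).val []) e) : s = (beadState b).val := by
  rw [travs_bead] at h
  interval_cases s <;> cases b <;> rcases he with rfl | rfl | rfl | rfl | rfl <;> revert h <;> decide

/-- **The chord equations of a crossing tile hold in the intended states**, and its ports carry
`r` (row in), `¬w` (column in), `¬r` (row out), `¬w` (column out). [folklore] -/
theorem cross_usesB (r w : Bool) :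
    let s := crossStates r w
    usesB (pc.travs.getD s.1.val []) pN0 = r ∧ usesB (pc.travs.getD s.1.val []) pN4 = !w ∧
    usesB (pc.travs.getD s.1.val []) pS2 = !usesB (pct.travs.getD s.2.1.val []) tS0 ∧
    usesB (pc.travs.getD s.1.val []) pS0 = !usesB (pct.travs.getD s.2.1.val []) tS4r ∧
    usesB (pct.travs.getD s.2.1.val []) tN2r = !usesB (pc.travs.getD s.2.2.val []) pN0 ∧
    usesB (pc.travs.getD s.1.val []) pN8 = !usesB (pc.travs.getD s.2.2.val []) pN4 ∧
    usesB (pc.travs.getD s.2.2.val []) pN8 = !r ∧ usesB (pct.travs.getD s.2.1.val []) tS8 = !w := by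
  rw [travs_pc, travs_pct]; cases r <;> cases w <;> decide

/-- **Local determination in a crossing tile**: valid states satisfying the two input equations and
the four chord equations are the intended ones. [folklore] -/
theorem cross_states_eq {s₁ s₂ s₃ : ℕ} (h₁ : s₁ < 4) (h₂ : s₂ < 4) (h₃ : s₃ < 4) (r w : Bool)
    (hin : usesB (pc.travs.getD s₁ []) pN0 = r) (hcol : usesB (pc.travs.getD s₁ []) pN4 = !w)
    (hc : usesB (pc.travs.getD s₁ []) pS2 = !usesB (pct.travs.getD s₂ []) tS0)
    (hr : usesB (pc.travs.getD s₁ []) pS0 = !usesB (pct.travs.getD s₂ []) tS4r)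
    (hk : usesB (pct.travs.getD s₂ []) tN2r = !usesB (pc.travs.getD s₃ []) pN0)
    (hc' : usesB (pc.travs.getD s₁ []) pN8 = !usesB (pc.travs.getD s₃ []) pN4) :
    s₁ = (crossStates r w).1.val ∧ s₂ = (crossStates r w).2.1.val ∧ s₃ = (crossStates r w).2.2.val := by
  rw [travs_pc, travs_pct] at *
  interval_cases s₁ <;> interval_cases s₂ <;> interval_cases s₃ <;> cases r <;> cases w <;> revert hin hcol hc hr hk hc' <;> decide

/-! ### Where the gadgets are: forward lemmas -/

/-- `gad` on a tile-gadget index. [folklore] -/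
theorem gad_tile {i j r : ℕ} (hi : i < V ψ) (hj : j < N ψ) (hr : r < 8) :
    gad ψ (8 * (i * N ψ + j) + r) = tileGad ψ i j r := by
  have hN : 0 < N ψ := by omega
  have hlt : i * N ψ + j < V ψ * N ψ := by
    calc i * N ψ + j < i * N ψ + N ψ := by omega
      _ = (i + 1) * N ψ := by ring
      _ ≤ V ψ * N ψ := Nat.mul_le_mul_right _ hi
  have h8 : (8 * (i * N ψ + j) + r) / 8 = i * N ψ + j := by omega
  have hdiv : (i * N ψ + j) / N ψ = i := by
    rw [Nat.add_div hN, Nat.mul_div_cancel _ hN, Nat.div_eq_of_lt hj]; simp [Nat.mod_eq_of_lt hj, not_le.2 hj]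
  have hmod : (i * N ψ + j) % N ψ = j := by rw [Nat.add_mod, Nat.mul_mod_left, zero_add, Nat.mod_mod, Nat.mod_eq_of_lt hj]
  unfold gad
  rw [if_pos (by omega), h8, hdiv, hmod, show (8 * (i * N ψ + j) + r) % 8 = r by omega]

/-- `gad` on a landing-chord index. [folklore] -/
theorem gad_land {j : ℕ} (hj : j < N ψ) :
    gad ψ (8 * (V ψ * N ψ) + j) = some (.xor (tileCell ψ (V ψ - 1) j 1) (colOutSlot ψ (V ψ - 1) j) (clauseBead ψ j) (landSlot ψ j)) := by
  unfold gad
  rw [if_neg (by omega), if_pos (by rw [Nat.add_sub_cancel_left]; exact hj), Nat.add_sub_cancel_left]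

/-- `gad` on a clause-gadget index. [folklore] -/
theorem gad_clause (q : ℕ) : gad ψ (8 * (V ψ * N ψ) + N ψ + q) = clauseGad ψ q := by
  unfold gad
  rw [if_neg (by omega), if_neg (by omega), show 8 * (V ψ * N ψ) + N ψ + q - 8 * (V ψ * N ψ) - N ψ = q by omega]

/-- Tile-gadget indices are gadget indices. [folklore] -/
theorem tile_lt_ngadgets {i j r : ℕ} (hi : i < V ψ) (hj : j < N ψ) (hr : r < 8) : 8 * (i * N ψ + j) + r < ngadgets ψ := by
  have : i * N ψ + j < V ψ * N ψ := by
    calc i * N ψ + j < i * N ψ + N ψ := by omega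
      _ = (i + 1) * N ψ := by ring
      _ ≤ V ψ * N ψ := Nat.mul_le_mul_right _ hi
  unfold ngadgets; omega

/-- Landing-chord indices are gadget indices. [folklore] -/
theorem land_lt_ngadgets {j : ℕ} (hj : j < N ψ) : 8 * (V ψ * N ψ) + j < ngadgets ψ := by unfold ngadgets; omega

/-- Clause-gadget indices are gadget indices. [folklore] -/
theorem clause_lt_ngadgets {q : ℕ} (hq : q < ψ.length) : 8 * (V ψ * N ψ) + N ψ + q < ngadgets ψ := by unfold ngadgets; omega

/-! ### Table conditions as equations between usage bits -/

/-- The table condition of gadget `g` for the index vector `σ`. [folklore] -/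
def Cond (σ : Fin (cellsOf ψ).length → Fin 4) (g : ℕ) : Prop :=
  ((family ψ).S g).filter (fun e => Uses (pathOfN (cellsOf ψ) (extN σ)) e) ∈ T ψ g

/-- Table conditions are decidable. [folklore] -/
instance (σ : Fin (cellsOf ψ).length → Fin 4) (g : ℕ) : Decidable (Cond ψ σ g) := by
  unfold Cond; infer_instance

variable {ψ}

/-- A guarded XOR-chord whose guard holds is placed. [folklore] -/
theorem xorAt?_isSome {g k₁ k₂ : ℕ} {e₁ e₂ : Fin 16 × Fin 16} (hk₁ : k₁ < ncells ψ) (hk₂ : k₂ < ncells ψ) (hne : k₁ ≠ k₂)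
    (he₁ : e₁.1 ≠ e₁.2) (he₂ : e₂.1 ≠ e₂.2) : ∃ P, xorAt? ψ g k₁ e₁ k₂ e₂ = some P := by
  unfold xorAt?
  rw [dif_pos ⟨hk₁, hk₂, hne, he₁, he₂⟩]
  exact ⟨_, rfl⟩

/-- **The condition of an XOR-chord is an inequality of usage bits.** [folklore] -/
theorem cond_xor_iff_ub {σ : Fin (cellsOf ψ).length → Fin 4} (hσ : ValidIdx (cellsOf ψ) σ) {g k₁ k₂ : ℕ} {e₁ e₂ : Fin 16 × Fin 16}
    (hs : gad ψ g = some (.xor k₁ e₁ k₂ e₂)) (hk₁ : k₁ < ncells ψ) (hk₂ : k₂ < ncells ψ) (hne : k₁ ≠ k₂)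
    (he₁ : e₁.1 ≠ e₁.2) (he₂ : e₂.1 ≠ e₂.2) : Cond ψ σ g ↔ ub ψ σ k₁ e₁ = !ub ψ σ k₂ e₂ := by
  obtain ⟨P, hP⟩ := xorAt?_isSome (g := g) hk₁ hk₂ hne he₁ he₂
  rw [Cond, cond_xor_iff ψ hs hP, uses_gs_iff hσ hk₁, uses_gs_iff hσ hk₂]
  cases ub ψ σ k₁ e₁ <;> cases ub ψ σ k₂ e₂ <;> simp

/-- **The condition of a one-input OR-gadget is a set usage bit.** [folklore] -/
theorem cond_or1_iff_ub {σ : Fin (cellsOf ψ).length → Fin 4} (hσ : ValidIdx (cellsOf ψ) σ) {g k : ℕ}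
    (hs : gad ψ g = some (.or1 k)) (hk : k < ncells ψ) : Cond ψ σ g ↔ ub ψ σ k bS0 = true := by
  obtain ⟨P, hP⟩ : ∃ P, or1At? ψ g k = some P := by unfold or1At?; rw [dif_pos hk]; exact ⟨_, rfl⟩
  rw [Cond, cond_or1_iff ψ hs hP, uses_gs_iff hσ hk]

/-- **The condition of a three-input OR-gadget is a disjunction of usage bits.** [folklore] -/
theorem cond_or3_iff_ub {σ : Fin (cellsOf ψ).length → Fin 4} (hσ : ValidIdx (cellsOf ψ) σ) {g k : ℕ}
    (hs : gad ψ g = some (.or3 k)) (hk : k + 2 < ncells ψ) :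
    Cond ψ σ g ↔ ub ψ σ k bS0 = true ∨ ub ψ σ (k + 1) bS0 = true ∨ ub ψ σ (k + 2) bS0 = true := by
  obtain ⟨P, hP⟩ : ∃ P, or3At? ψ g k = some P := by unfold or3At?; rw [dif_pos hk]; exact ⟨_, rfl⟩
  rw [Cond, cond_or3_iff ψ hs hP, uses_gs_iff hσ (by omega), uses_gs_iff hσ (by omega), uses_gs_iff hσ hk]

/-- Conditions of absent gadgets hold. [folklore] -/
theorem cond_of_place_none {σ : Fin (cellsOf ψ).length → Fin 4} {g : ℕ} (h : place ψ g = none) : Cond ψ σ g := by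
  rw [Cond, family_S_none ψ h, T, h]
  simp

variable (ψ)

/-! ### The usage bits of the intended states at the ports and chords of the tiles -/

/-- The intended vector is valid. [folklore] -/
theorem validIdx_stateOf (xr : ℕ → Bool) (d : Bool) : ValidIdx (cellsOf ψ) (stateOf ψ xr d) := by
  intro ⟨k, hk⟩
  rw [length_cellsOf] at hk
  rw [cellTy_cellsOf ψ hk]
  show (stateAt ψ xr d k).val < (cellTyAt ψ k).ntrav
  rcases Nat.eq_zero_or_pos k with rfl | hpos
  · rw [stateAt_zero, cellTyAt_zero]; exact beadState_lt d
  · by_cases hlt : k < 1 + 3 * (V ψ * N ψ)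
    · -- a tile cell: decode
      have hN : 0 < N ψ := Nat.pos_of_ne_zero fun h => by rw [h] at hlt; simp at hlt; omega
      set t := (k - 1) / 3
      have ht : t < V ψ * N ψ := by omega
      have hi : t / N ψ < V ψ := (Nat.div_lt_iff_lt_mul hN).2 ht
      have hj : t % N ψ < N ψ := Nat.mod_lt _ hN
      have hk' : k = tileCell ψ (t / N ψ) (t % N ψ) ((k - 1) % 3) := by
        have h1 := Nat.div_add_mod t (N ψ)
        have h2 : t / N ψ * N ψ = N ψ * (t / N ψ) := Nat.mul_comm _ _
        have h3 := Nat.div_add_mod (k - 1) 3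
        unfold tileCell; omega
      rw [hk', stateAt_tileCell ψ xr d hi hj (Nat.mod_lt _ (by omega)), cellTyAt_tileCell ψ hi hj (Nat.mod_lt _ (by omega))]
      split_ifs with hc h0 h1
      · exact Fin.isLt _
      · exact Fin.isLt _
      · exact Fin.isLt _
      · exact beadState_lt _
    · have hk' : k = clauseBead ψ (k - (1 + 3 * (V ψ * N ψ))) := by unfold clauseBead; omega
      rw [hk', stateAt_clauseBead, cellTyAt_clauseBead]; exact beadState_lt _

/-- The usage bit of the intended vector at a cell is computed from `stateAt`. [folklore] -/
theorem ub_stateOf (xr : ℕ → Bool) (d : Bool) {k : ℕ} (hk : k < ncells ψ) (e : Fin 16 × Fin 16) :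
    ub ψ (stateOf ψ xr d) k e = usesB ((cellTyAt ψ k).travs.getD (stateAt ψ xr d k).val []) e := by
  rw [ub, extN_stateOf ψ xr d hk]

/-- The column usage bit flips from each row to the next below the variable's row. [folklore] -/
theorem colBit_succ (xr : ℕ → Bool) {i j : ℕ} (h : rowOf ψ (varOf ψ j) < i) : colBit ψ xr i j = !colBit ψ xr (i - 1) j := by
  unfold colBit
  have : (i - rowOf ψ (varOf ψ j)) % 2 = 0 ↔ ¬ (i - 1 - rowOf ψ (varOf ψ j)) % 2 = 0 := by omega
  by_cases h0 : (i - rowOf ψ (varOf ψ j)) % 2 = 0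
  · rw [decide_eq_true h0, decide_eq_false (this.1 h0)]; cases xr (rowOf ψ (varOf ψ j)) <;> rfl
  · rw [decide_eq_false h0, decide_eq_true (by tauto)]; cases xr (rowOf ψ (varOf ψ j)) <;> rfl

/-- The column usage bit on the variable's own row (the tap): the complement of the variable. [folklore] -/
theorem colBit_self (xr : ℕ → Bool) (j : ℕ) : colBit ψ xr (rowOf ψ (varOf ψ j)) j = !xr (rowOf ψ (varOf ψ j)) := by
  unfold colBit; simp

/-- **Ports of a one-bit tile** (`empty` or `tap`) in the intended states: row in `= r`, row out `= ¬r`,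
inner chord ends `¬r / r`, column out `= ¬r`. [folklore] -/
theorem ports_bead_tile (xr : ℕ → Bool) (d : Bool) {i j : ℕ} (hi : i < V ψ) (hj : j < N ψ) (h : tileTy ψ i j ≠ .cross) :
    ub ψ (stateOf ψ xr d) (tileCell ψ i j 0) bN3 = xr i ∧ ub ψ (stateOf ψ xr d) (tileCell ψ i j 0) bN6 = !xr i ∧
    ub ψ (stateOf ψ xr d) (tileCell ψ i j 1) bN3 = xr i ∧ ub ψ (stateOf ψ xr d) (tileCell ψ i j 1) bN6 = !xr i ∧
    ub ψ (stateOf ψ xr d) (tileCell ψ i j 2) bN3 = xr i ∧ ub ψ (stateOf ψ xr d) (tileCell ψ i j 2) bN6 = !xr i ∧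
    ub ψ (stateOf ψ xr d) (tileCell ψ i j 1) bS1 = !xr i := by
  have hst : ∀ c < 3, stateAt ψ xr d (tileCell ψ i j c) = beadState (xr i) := fun c hc => by
    rw [stateAt_tileCell ψ xr d hi hj hc, if_neg h]
  have hty : ∀ c < 3, cellTyAt ψ (tileCell ψ i j c) = .bead := (cellTyAt_tileCell_cases ψ hi hj).2 h
  have hub : ∀ c < 3, ∀ e, ub ψ (stateOf ψ xr d) (tileCell ψ i j c) e = usesB (bead.travs.getD (beadState (xr i)).val []) e :=
    fun c hc e => by rw [ub_stateOf ψ xr d (tileCell_lt_ncells ψ hi hj hc), hty c hc, hst c hc]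
  obtain ⟨h1, h2, h3, h4, -⟩ := usesB_beadState (xr i)
  simp only [hub 0 (by omega), hub 1 (by omega), hub 2 (by omega), h2, h3, h4, and_self]

/-- **Ports and chords of a crossing tile** in the intended states. [folklore] -/
theorem ports_cross_tile (xr : ℕ → Bool) (d : Bool) {i j : ℕ} (hi : i < V ψ) (hj : j < N ψ) (h : tileTy ψ i j = .cross) :
    let σ := stateOf ψ xr d
    let w := colBit ψ xr (i - 1) j
    ub ψ σ (tileCell ψ i j 0) pN0 = xr i ∧ ub ψ σ (tileCell ψ i j 0) pN4 = !w ∧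
    ub ψ σ (tileCell ψ i j 0) pS2 = !ub ψ σ (tileCell ψ i j 1) tS0 ∧
    ub ψ σ (tileCell ψ i j 0) pS0 = !ub ψ σ (tileCell ψ i j 1) tS4r ∧
    ub ψ σ (tileCell ψ i j 1) tN2r = !ub ψ σ (tileCell ψ i j 2) pN0 ∧
    ub ψ σ (tileCell ψ i j 0) pN8 = !ub ψ σ (tileCell ψ i j 2) pN4 ∧
    ub ψ σ (tileCell ψ i j 2) pN8 = !xr i ∧ ub ψ σ (tileCell ψ i j 1) tS8 = !w := by
  intro σ w
  obtain ⟨ht0, ht1, ht2⟩ := (cellTyAt_tileCell_cases ψ hi hj).1 h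
  have hs0 : stateAt ψ xr d (tileCell ψ i j 0) = (crossStates (xr i) w).1 := by
    rw [stateAt_tileCell ψ xr d hi hj (by omega), if_pos h, if_pos rfl]
  have hs1 : stateAt ψ xr d (tileCell ψ i j 1) = (crossStates (xr i) w).2.1 := by
    rw [stateAt_tileCell ψ xr d hi hj (by omega), if_pos h, if_neg (by omega), if_pos rfl]
  have hs2 : stateAt ψ xr d (tileCell ψ i j 2) = (crossStates (xr i) w).2.2 := by
    rw [stateAt_tileCell ψ xr d hi hj (by omega), if_pos h, if_neg (by omega), if_neg (by omega)]
  have hu0 : ∀ e, ub ψ σ (tileCell ψ i j 0) e = usesB (pc.travs.getD (crossStates (xr i) w).1.val []) e := fun e => by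
    show ub ψ (stateOf ψ xr d) _ e = _; rw [ub_stateOf ψ xr d (tileCell_lt_ncells ψ hi hj (by omega)), ht0, hs0]
  have hu1 : ∀ e, ub ψ σ (tileCell ψ i j 1) e = usesB (pct.travs.getD (crossStates (xr i) w).2.1.val []) e := fun e => by
    show ub ψ (stateOf ψ xr d) _ e = _; rw [ub_stateOf ψ xr d (tileCell_lt_ncells ψ hi hj (by omega)), ht1, hs1]
  have hu2 : ∀ e, ub ψ σ (tileCell ψ i j 2) e = usesB (pc.travs.getD (crossStates (xr i) w).2.2.val []) e := fun e => by
    show ub ψ (stateOf ψ xr d) _ e = _; rw [ub_stateOf ψ xr d (tileCell_lt_ncells ψ hi hj (by omega)), ht2, hs2]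
  simp only [hu0, hu1, hu2]
  exact cross_usesB (xr i) w

/-- **The row-in port of any tile carries the row bit.** [folklore] -/
theorem ub_rowIn (xr : ℕ → Bool) (d : Bool) {i j : ℕ} (hi : i < V ψ) (hj : j < N ψ) :
    ub ψ (stateOf ψ xr d) (tileCell ψ i j 0) (rowInSlot ψ i j) = xr i := by
  unfold rowInSlot
  by_cases h : tileTy ψ i j = .cross
  · rw [if_pos h]; exact (ports_cross_tile ψ xr d hi hj h).1
  · rw [if_neg h]; exact (ports_bead_tile ψ xr d hi hj h).1

/-- **The row-out port of any tile carries the complement of the row bit.** [folklore] -/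
theorem ub_rowOut (xr : ℕ → Bool) (d : Bool) {i j : ℕ} (hi : i < V ψ) (hj : j < N ψ) :
    ub ψ (stateOf ψ xr d) (tileCell ψ i j 2) (rowOutSlot ψ i j) = !xr i := by
  unfold rowOutSlot
  by_cases h : tileTy ψ i j = .cross
  · rw [if_pos h]; exact (ports_cross_tile ψ xr d hi hj h).2.2.2.2.2.2.1
  · rw [if_neg h]; exact (ports_bead_tile ψ xr d hi hj h).2.2.2.2.2.1

/-- **The column-out port of a tap or a crossing carries the column usage bit.** [folklore] -/
theorem ub_colOut (xr : ℕ → Bool) (d : Bool) {i j : ℕ} (hi : i < V ψ) (hj : j < N ψ) (h : tileTy ψ i j ≠ .empty) :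
    ub ψ (stateOf ψ xr d) (tileCell ψ i j 1) (colOutSlot ψ i j) = colBit ψ xr i j := by
  unfold colOutSlot
  by_cases hc : tileTy ψ i j = .cross
  · rw [if_neg (by rw [hc]; decide), (ports_cross_tile ψ xr d hi hj hc).2.2.2.2.2.2.2, ← colBit_succ ψ xr ((tileTy_eq_cross_iff ψ).1 hc)]
  · have ht : tileTy ψ i j = .tap := by cases h' : tileTy ψ i j <;> simp_all
    rw [if_pos ht, (ports_bead_tile ψ xr d hi hj hc).2.2.2.2.2.2, (tileTy_eq_tap_iff ψ).1 ht, colBit_self]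

/-- **The landing parity rule**: the terminal carrying the literal's value uses its landing slot iff
the column usage bit arriving from the last row is clear. [folklore] -/
theorem ub_land (xr : ℕ → Bool) (d : Bool) {j : ℕ} (hj : j < N ψ) :
    ub ψ (stateOf ψ xr d) (clauseBead ψ j) (landSlot ψ j) = !colBit ψ xr (V ψ - 1) j ∧
    ub ψ (stateOf ψ xr d) (clauseBead ψ j) bS0 = litVal ψ xr j := by
  have hk := clauseBead_lt_ncells ψ hj
  have hv := rowOf_varOf_lt ψ hj
  rw [ub_stateOf ψ xr d hk, ub_stateOf ψ xr d hk, cellTyAt_clauseBead, stateAt_clauseBead]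
  obtain ⟨h1, h2, -, -, h5⟩ := usesB_beadState (litVal ψ xr j)
  refine ⟨?_, h1⟩
  set v := rowOf ψ (varOf ψ j) with hv_def
  unfold landSlot
  by_cases hc : (V ψ - 1 - v) % 2 = (if polOf ψ j then 0 else 1)
  · rw [if_pos hc, h2]
    unfold litVal colBit
    rw [← hv_def]
    cases hp : polOf ψ j
    · rw [hp, if_neg Bool.false_ne_true] at hc
      rw [decide_eq_false (show ¬ (V ψ - 1 - v) % 2 = 0 by omega)]
      cases xr v <;> rfl
    · rw [hp, if_pos rfl] at hc
      rw [decide_eq_true hc]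
      cases xr v <;> rfl
  · rw [if_neg hc, h5]
    unfold litVal colBit
    rw [← hv_def]
    cases hp : polOf ψ j
    · rw [hp, if_neg Bool.false_ne_true] at hc
      rw [decide_eq_true (show (V ψ - 1 - v) % 2 = 0 by omega)]
      cases xr v <;> rfl
    · rw [hp, if_pos rfl] at hc
      rw [decide_eq_false hc]
      cases xr v <;> rfl


/-! ### The intended states satisfy every chord condition -/

/-- Distinct cells of one tile. [folklore] -/
theorem tileCell_ne {i j c c' : ℕ} (hj : j < N ψ) (hc : c < 3) (hc' : c' < 3) (h : c ≠ c') :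
    tileCell ψ i j c ≠ tileCell ψ i j c' := fun heq => h (tileCell_inj ψ hj hc hj hc' heq).2.2

/-- Cells of different columns differ. [folklore] -/
theorem tileCell_ne_of_col {i i' j j' c c' : ℕ} (hj : j < N ψ) (hc : c < 3) (hj' : j' < N ψ) (hc' : c' < 3) (h : j ≠ j') :
    tileCell ψ i j c ≠ tileCell ψ i' j' c' := fun heq => h (tileCell_inj ψ hj hc hj' hc' heq).2.1

/-- Cells of different rows differ. [folklore] -/
theorem tileCell_ne_of_row {i i' j j' c c' : ℕ} (hj : j < N ψ) (hc : c < 3) (hj' : j' < N ψ) (hc' : c' < 3) (h : i ≠ i') :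
    tileCell ψ i j c ≠ tileCell ψ i' j' c' := fun heq => h (tileCell_inj ψ hj hc hj' hc' heq).1

/-- An absent specification is an absent gadget. [folklore] -/
theorem place_eq_none_of_gad {g : ℕ} (h : gad ψ g = none) : place ψ g = none := by rw [place, h]; rfl

/-- **Every tile-gadget condition holds in the intended states.** [folklore] -/
theorem cond_stateOf_tile (xr : ℕ → Bool) (d : Bool) {i j r : ℕ} (hi : i < V ψ) (hj : j < N ψ) (hr : r < 8) :
    Cond ψ (stateOf ψ xr d) (8 * (i * N ψ + j) + r) := by
  have hσ := validIdx_stateOf ψ xr d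
  have hs := gad_tile ψ hi hj hr
  have hcells : ∀ c < 3, tileCell ψ i j c < ncells ψ := fun c hc => tileCell_lt_ncells ψ hi hj hc
  unfold tileGad at hs
  by_cases hcross : tileTy ψ i j = .cross
  · rw [if_pos hcross] at hs
    have hp := ports_cross_tile ψ xr d hi hj hcross
    have hlt : rowOf ψ (varOf ψ j) < i := (tileTy_eq_cross_iff ψ).1 hcross
    interval_cases r
    · by_cases hj0 : j = 0
      · simp only [hj0, ↓reduceIte] at hs
        exact cond_of_place_none (place_eq_none_of_gad ψ (by simpa [hj0] using hs))
      · simp only [↓reduceIte, hj0] at hs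
        have hj1 : j - 1 < N ψ := by omega
        have hro := rowOutSlot_adj ψ hi hj1
        refine (cond_xor_iff_ub hσ hs (tileCell_lt_ncells ψ hi hj1 (by omega)) (hcells 0 (by omega))
          (tileCell_ne_of_col ψ hj1 (by omega) hj (by omega) (by omega)) (ne_of_canon hro.2.1) (by decide)).2 ?_
        have h1 := ub_rowOut ψ xr d hi hj1
        have h2 := ub_rowIn ψ xr d hi hj
        rw [rowInSlot, if_pos hcross] at h2
        rw [h1, h2]
    · simp only [show (1 : ℕ) ≠ 0 from one_ne_zero, ↓reduceIte] at hs
      exact (cond_xor_iff_ub hσ hs (hcells 0 (by omega)) (hcells 1 (by omega)) (tileCell_ne ψ hj (by omega) (by omega) (by omega))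
        (by decide) (by decide)).2 hp.2.2.1
    · simp only [show (2 : ℕ) ≠ 0 from two_ne_zero, show (2 : ℕ) ≠ 1 by decide, ↓reduceIte] at hs
      exact (cond_xor_iff_ub hσ hs (hcells 0 (by omega)) (hcells 1 (by omega)) (tileCell_ne ψ hj (by omega) (by omega) (by omega))
        (by decide) (by decide)).2 hp.2.2.2.1
    · simp only [show (3 : ℕ) ≠ 0 by decide, show (3 : ℕ) ≠ 1 by decide, show (3 : ℕ) ≠ 2 by decide, ↓reduceIte] at hs
      exact (cond_xor_iff_ub hσ hs (hcells 1 (by omega)) (hcells 2 (by omega)) (tileCell_ne ψ hj (by omega) (by omega) (by omega))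
        (by decide) (by decide)).2 hp.2.2.2.2.1
    · simp only [show (4 : ℕ) ≠ 0 by decide, show (4 : ℕ) ≠ 1 by decide, show (4 : ℕ) ≠ 2 by decide, show (4 : ℕ) ≠ 3 by decide,
        ↓reduceIte] at hs
      exact (cond_xor_iff_ub hσ hs (hcells 0 (by omega)) (hcells 2 (by omega)) (tileCell_ne ψ hj (by omega) (by omega) (by omega))
        (by decide) (by decide)).2 hp.2.2.2.2.2.1
    · simp only [show (5 : ℕ) ≠ 0 by decide, show (5 : ℕ) ≠ 1 by decide, show (5 : ℕ) ≠ 2 by decide, show (5 : ℕ) ≠ 3 by decide,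
        show (5 : ℕ) ≠ 4 by decide, ↓reduceIte] at hs
      have hi1 : i - 1 < V ψ := by omega
      have hne : tileTy ψ (i - 1) j ≠ .empty := tileTy_ne_empty_of_le ψ (by omega)
      have hco := colOutSlot_adj ψ hi1 hj hne
      refine (cond_xor_iff_ub hσ hs (tileCell_lt_ncells ψ hi1 hj (by omega)) (hcells 0 (by omega))
        (tileCell_ne_of_row ψ hj (by omega) hj (by omega) (by omega)) (ne_of_canon hco.2.1) (by decide)).2 ?_
      rw [ub_colOut ψ xr d hi1 hj hne, hp.2.1, Bool.not_not]
    · simp at hs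
      exact cond_of_place_none (place_eq_none_of_gad ψ hs)
    · simp at hs
      exact cond_of_place_none (place_eq_none_of_gad ψ hs)
  · rw [if_neg hcross] at hs
    have hp := ports_bead_tile ψ xr d hi hj hcross
    interval_cases r
    · by_cases hj0 : j = 0
      · simp only [hj0, ↓reduceIte] at hs
        exact cond_of_place_none (place_eq_none_of_gad ψ (by simpa [hj0] using hs))
      · simp only [↓reduceIte, hj0] at hs
        have hj1 : j - 1 < N ψ := by omega
        have hro := rowOutSlot_adj ψ hi hj1
        refine (cond_xor_iff_ub hσ hs (tileCell_lt_ncells ψ hi hj1 (by omega)) (hcells 0 (by omega))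
          (tileCell_ne_of_col ψ hj1 (by omega) hj (by omega) (by omega)) (ne_of_canon hro.2.1) (by decide)).2 ?_
        have h1 := ub_rowOut ψ xr d hi hj1
        have h2 := ub_rowIn ψ xr d hi hj
        rw [rowInSlot, if_neg hcross] at h2
        rw [h1, h2]
    · simp only [show (1 : ℕ) ≠ 0 from one_ne_zero, ↓reduceIte] at hs
      exact (cond_xor_iff_ub hσ hs (hcells 0 (by omega)) (hcells 1 (by omega)) (tileCell_ne ψ hj (by omega) (by omega) (by omega))
        (by decide) (by decide)).2 (by rw [hp.2.1, hp.2.2.1])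
    · simp only [show (2 : ℕ) ≠ 0 from two_ne_zero, show (2 : ℕ) ≠ 1 by decide, ↓reduceIte] at hs
      exact (cond_xor_iff_ub hσ hs (hcells 1 (by omega)) (hcells 2 (by omega)) (tileCell_ne ψ hj (by omega) (by omega) (by omega))
        (by decide) (by decide)).2 (by rw [hp.2.2.2.1, hp.2.2.2.2.1])
    all_goals simp at hs; exact cond_of_place_none (place_eq_none_of_gad ψ hs)

/-- **The landing-chord condition holds in the intended states.** [folklore] -/
theorem cond_stateOf_land (xr : ℕ → Bool) (d : Bool) {j : ℕ} (hj : j < N ψ) : Cond ψ (stateOf ψ xr d) (8 * (V ψ * N ψ) + j) := by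
  have hσ := validIdx_stateOf ψ xr d
  have hs := gad_land ψ hj
  have hV : 0 < V ψ := V_pos_of_N_pos ψ (by omega)
  have hv := rowOf_varOf_lt ψ hj
  have hne : tileTy ψ (V ψ - 1) j ≠ .empty := tileTy_ne_empty_of_le ψ (by omega)
  have hco := colOutSlot_adj ψ (i := V ψ - 1) (by omega) hj hne
  have hls := landSlot_props ψ j
  refine (cond_xor_iff_ub hσ hs (tileCell_lt_ncells ψ (by omega) hj (by omega)) (clauseBead_lt_ncells ψ hj)
    (tileCell_ne_clauseBead ψ (by omega) hj (by omega) j) (ne_of_canon hco.2.1) (ne_of_canon hls.2.1)).2 ?_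
  rw [ub_colOut ψ xr d (by omega) hj hne, (ub_land ψ xr d hj).1, Bool.not_not]

/-- The literal of a column of clause `q` is the `m`-th literal of the clause. [folklore] -/
theorem cols_getElem_cstart_add {q : ℕ} (hq : q < ψ.length) {m : ℕ} (hm : m < ψ[q].length) :
    (cols ψ)[cstart ψ q + m]'(cstart_add_lt ψ hq hm) = ψ[q][m] := by
  have hsplit : cols ψ = (ψ.take q).flatten ++ (ψ[q] ++ (ψ.drop (q + 1)).flatten) := by
    unfold cols
    conv_lhs => rw [← List.take_append_drop q ψ, List.drop_eq_getElem_cons hq]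
    rw [List.flatten_append, List.flatten_cons]
  simp only [hsplit, cstart]
  rw [List.getElem_append_right (by omega)]
  simp only [Nat.add_sub_cancel_left]
  rw [List.getElem_append_left hm]

/-- The value of the literal of a column of clause `q` is the value of the `m`-th literal under the
assignment reading the rows. [folklore] -/
theorem litVal_cstart_add (xr : ℕ → Bool) {q : ℕ} (hq : q < ψ.length) {m : ℕ} (hm : m < ψ[q].length) :
    litVal ψ xr (cstart ψ q + m) = Literal.eval (fun y => xr (rowOf ψ y)) ψ[q][m] := by
  have h := cols_getElem ψ (cstart_add_lt ψ hq hm)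
  rw [cols_getElem_cstart_add ψ hq hm] at h
  unfold litVal Literal.eval
  rw [h]

/-- **The OR-gadget condition of a clause of width one or three holds iff the clause is true** under
the assignment reading the rows. [folklore] -/
theorem cond_stateOf_clause_iff (xr : ℕ → Bool) (d : Bool) {q : ℕ} (hq : q < ψ.length) (hw : ψ[q].length = 1 ∨ ψ[q].length = 3) :
    Cond ψ (stateOf ψ xr d) (8 * (V ψ * N ψ) + N ψ + q) ↔ Clause.eval (fun y => xr (rowOf ψ y)) ψ[q] = true := by
  have hσ := validIdx_stateOf ψ xr d
  have hs := gad_clause ψ q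
  unfold clauseGad at hs
  rw [dif_pos hq] at hs
  have hcb : ∀ m, clauseBead ψ (cstart ψ q) + m = clauseBead ψ (cstart ψ q + m) := fun m => by unfold clauseBead; omega
  have hlit : ∀ m (hm : m < ψ[q].length), ub ψ (stateOf ψ xr d) (clauseBead ψ (cstart ψ q + m)) bS0 =
      Literal.eval (fun y => xr (rowOf ψ y)) ψ[q][m] := fun m hm => by
    rw [(ub_land ψ xr d (cstart_add_lt ψ hq hm)).2, litVal_cstart_add ψ xr hq hm]
  have heval : Clause.eval (fun y => xr (rowOf ψ y)) ψ[q] = true ↔ ∃ m, ∃ hm : m < ψ[q].length,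
      Literal.eval (fun y => xr (rowOf ψ y)) ψ[q][m] = true := by
    rw [Clause.eval, List.any_eq_true]
    constructor
    · rintro ⟨l, hl, h⟩
      obtain ⟨m, hm, rfl⟩ := List.getElem_of_mem hl
      exact ⟨m, hm, h⟩
    · rintro ⟨m, hm, h⟩
      exact ⟨_, List.getElem_mem hm, h⟩
  rcases hw with h1 | h3
  · rw [if_pos h1] at hs
    rw [cond_or1_iff_ub hσ hs (clauseBead_lt_ncells ψ (by have := cstart_add_lt ψ hq (m := 0) (by omega); omega)), heval,
      show cstart ψ q = cstart ψ q + 0 from rfl, hlit 0 (by omega)]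
    constructor
    · intro h; exact ⟨0, by omega, h⟩
    · rintro ⟨m, hm, h⟩
      have : m = 0 := by omega
      subst this; exact h
  · rw [if_neg (by omega), if_pos h3] at hs
    have hlt2 := cstart_add_lt ψ hq (m := 2) (by omega)
    rw [cond_or3_iff_ub hσ hs (by rw [hcb 2]; exact clauseBead_lt_ncells ψ hlt2), heval, hcb 1, hcb 2,
      hlit 1 (by omega), hlit 2 (by omega), show clauseBead ψ (cstart ψ q) = clauseBead ψ (cstart ψ q + 0) from rfl,
      hlit 0 (by omega)]
    constructor
    · rintro (h | h | h)
      exacts [⟨0, by omega, h⟩, ⟨1, by omega, h⟩, ⟨2, by omega, h⟩]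
    · rintro ⟨m, hm, h⟩
      have : m = 0 ∨ m = 1 ∨ m = 2 := by omega
      rcases this with rfl | rfl | rfl
      exacts [Or.inl h, Or.inr (Or.inl h), Or.inr (Or.inr h)]

/-- **All conditions hold in the intended states iff the formula is true** under the assignment reading
the rows (clauses of width one or three). [folklore] -/
theorem forall_cond_stateOf_iff (xr : ℕ → Bool) (d : Bool) (hw : ∀ q (hq : q < ψ.length), ψ[q].length = 1 ∨ ψ[q].length = 3) :
    (∀ g < ngadgets ψ, Cond ψ (stateOf ψ xr d) g) ↔ ψ.eval (fun y => xr (rowOf ψ y)) = true := by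
  rw [CNF.eval, List.all_eq_true]
  constructor
  · intro h c hc
    obtain ⟨q, hq, rfl⟩ := List.getElem_of_mem hc
    exact (cond_stateOf_clause_iff ψ xr d hq (hw q hq)).1 (h _ (clause_lt_ngadgets ψ hq))
  · intro h g hg
    by_cases h8 : g < 8 * (V ψ * N ψ)
    · obtain ⟨hi, hj, hgeq⟩ := decode_tile ψ h8
      rw [hgeq]
      exact cond_stateOf_tile ψ xr d hi hj (Nat.mod_lt _ (by omega))
    · by_cases hl : g - 8 * (V ψ * N ψ) < N ψ
      · have : g = 8 * (V ψ * N ψ) + (g - 8 * (V ψ * N ψ)) := by omega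
        rw [this]
        exact cond_stateOf_land ψ xr d hl
      · have hq : g - 8 * (V ψ * N ψ) - N ψ < ψ.length := by unfold ngadgets at hg; omega
        have : g = 8 * (V ψ * N ψ) + N ψ + (g - 8 * (V ψ * N ψ) - N ψ) := by omega
        rw [this]
        exact (cond_stateOf_clause_iff ψ xr d hq (hw _ hq)).2 (h _ (List.getElem_mem hq))

/-! ### Uniqueness: every solution is an intended vector -/

/-- **The row bits read off a solution**: the row-in usage bit of the first tile of each row. [folklore] -/
def rowBits (σ : Fin (cellsOf ψ).length → Fin 4) (i : ℕ) : Bool := ub ψ σ (tileCell ψ i 0 0) (rowInSlot ψ i 0)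

/-- **The doubling bit read off a solution.** [folklore] -/
def dBit (σ : Fin (cellsOf ψ).length → Fin 4) : Bool := ub ψ σ 0 bS0

variable {ψ}

/-- Matching states give matching usage bits. [folklore] -/
theorem ub_of_match {σ : Fin (cellsOf ψ).length → Fin 4} {xr : ℕ → Bool} {d : Bool} {k : ℕ} (hk : k < ncells ψ)
    (h : extN σ k = (stateAt ψ xr d k).val) (e : Fin 16 × Fin 16) : ub ψ σ k e = ub ψ (stateOf ψ xr d) k e := by
  rw [ub, ub, h, extN_stateOf ψ xr d hk]

/-- The extension of `σ` at an existing cell is its value. [folklore] -/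
theorem extN_eq_val {σ : Fin (cellsOf ψ).length → Fin 4} {k : ℕ} (hk : k < ncells ψ) :
    extN σ k = (σ ⟨k, by rwa [length_cellsOf]⟩).val := by
  rw [extN, dif_pos]

/-- A valid index at a cell of a given type is below the number of traversals. [folklore] -/
theorem extN_lt_ntrav {σ : Fin (cellsOf ψ).length → Fin 4} (hσ : ValidIdx (cellsOf ψ) σ) {k : ℕ} (hk : k < ncells ψ) :
    extN σ k < (cellTyAt ψ k).ntrav := by
  rw [← cellTy_cellsOf ψ hk]; exact extN_lt hσ k (by rwa [length_cellsOf])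

/-- **Local determination of a one-bit cell** by one of its bits. [folklore] -/
theorem extN_eq_beadState {σ : Fin (cellsOf ψ).length → Fin 4} (hσ : ValidIdx (cellsOf ψ) σ) {k : ℕ} (hk : k < ncells ψ)
    (hty : cellTyAt ψ k = .bead) {e : Fin 16 × Fin 16} (he : e = bS0 ∨ e = bN3 ∨ e = bN6 ∨ e = bS1 ∨ e = bN0) (b : Bool)
    (h : ub ψ σ k e = usesB (bead.travs.getD (beadState b).val []) e) : extN σ k = (beadState b).val := by
  have hlt := extN_lt_ntrav hσ hk
  rw [hty] at hlt
  rw [ub, hty] at h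
  exact bead_state_eq hlt e he b h

variable (ψ)

/-- A tile matches: its three cells are in the intended states. [folklore] -/
def TileMatch (σ : Fin (cellsOf ψ).length → Fin 4) (xr : ℕ → Bool) (d : Bool) (i j : ℕ) : Prop :=
  ∀ c < 3, extN σ (tileCell ψ i j c) = (stateAt ψ xr d (tileCell ψ i j c)).val

variable {ψ}

/-- **Propagation through one tile**: if the tile to the west (if any) and the tile to the north (for a
crossing) match, so does the tile. [folklore] -/
theorem tileMatch_step {σ : Fin (cellsOf ψ).length → Fin 4} (hσ : ValidIdx (cellsOf ψ) σ) (hsat : ∀ g < ngadgets ψ, Cond ψ σ g)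
    {d : Bool} {i j : ℕ} (hi : i < V ψ) (hj : j < N ψ)
    (hwest : 0 < j → TileMatch ψ σ (rowBits ψ σ) d i (j - 1))
    (hnorth : tileTy ψ i j = .cross → TileMatch ψ σ (rowBits ψ σ) d (i - 1) j) :
    TileMatch ψ σ (rowBits ψ σ) d i j := by
  set xr := rowBits ψ σ with hxr
  have hcells : ∀ c < 3, tileCell ψ i j c < ncells ψ := fun c hc => tileCell_lt_ncells ψ hi hj hc
  -- the row-in bit
  have hrin : ub ψ σ (tileCell ψ i j 0) (rowInSlot ψ i j) = xr i := by
    rcases Nat.eq_zero_or_pos j with rfl | hjpos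
    · rfl
    · have hj1 : j - 1 < N ψ := by omega
      have hro := rowOutSlot_adj ψ hi hj1
      have hs := gad_tile ψ hi hj (show 0 < 8 by omega)
      have hc := hsat _ (tile_lt_ngadgets ψ hi hj (show 0 < 8 by omega))
      unfold tileGad at hs
      have hout : ub ψ σ (tileCell ψ i (j - 1) 2) (rowOutSlot ψ i (j - 1)) = !xr i := by
        rw [ub_of_match (tileCell_lt_ncells ψ hi hj1 (by omega)) (hwest hjpos 2 (by omega)), ub_rowOut ψ xr d hi hj1]
      by_cases hcross : tileTy ψ i j = .cross
      · rw [if_pos hcross, if_pos rfl, if_neg (by omega)] at hs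
        have := (cond_xor_iff_ub hσ hs (tileCell_lt_ncells ψ hi hj1 (by omega)) (hcells 0 (by omega))
          (tileCell_ne_of_col ψ hj1 (by omega) hj (by omega) (by omega)) (ne_of_canon hro.2.1) (by decide)).1 hc
        rw [hout] at this
        rw [rowInSlot, if_pos hcross]
        cases h' : ub ψ σ (tileCell ψ i j 0) pN0 <;> cases hx : xr i <;> simp_all
      · rw [if_neg hcross, if_pos rfl, if_neg (by omega)] at hs
        have := (cond_xor_iff_ub hσ hs (tileCell_lt_ncells ψ hi hj1 (by omega)) (hcells 0 (by omega))
          (tileCell_ne_of_col ψ hj1 (by omega) hj (by omega) (by omega)) (ne_of_canon hro.2.1) (by decide)).1 hc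
        rw [hout] at this
        rw [rowInSlot, if_neg hcross]
        cases h' : ub ψ σ (tileCell ψ i j 0) bN3 <;> cases hx : xr i <;> simp_all
  by_cases hcross : tileTy ψ i j = .cross
  · -- a crossing: the column-in bit, then the six equations determine the three cells
    obtain ⟨ht0, ht1, ht2⟩ := (cellTyAt_tileCell_cases ψ hi hj).1 hcross
    have hlt : rowOf ψ (varOf ψ j) < i := (tileTy_eq_cross_iff ψ).1 hcross
    have hi1 : i - 1 < V ψ := by omega
    have hne : tileTy ψ (i - 1) j ≠ .empty := tileTy_ne_empty_of_le ψ (by omega)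
    set w := colBit ψ xr (i - 1) j with hw
    have hcin : ub ψ σ (tileCell ψ i j 0) pN4 = !w := by
      have hs := gad_tile ψ hi hj (show 5 < 8 by omega)
      have hc := hsat _ (tile_lt_ngadgets ψ hi hj (show 5 < 8 by omega))
      unfold tileGad at hs
      simp only [hcross, ↓reduceIte, show (5 : ℕ) ≠ 0 by decide, show (5 : ℕ) ≠ 1 by decide, show (5 : ℕ) ≠ 2 by decide,
        show (5 : ℕ) ≠ 3 by decide, show (5 : ℕ) ≠ 4 by decide] at hs
      have hco := colOutSlot_adj ψ hi1 hj hne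
      have := (cond_xor_iff_ub hσ hs (tileCell_lt_ncells ψ hi1 hj (by omega)) (hcells 0 (by omega))
        (tileCell_ne_of_row ψ hj (by omega) hj (by omega) (by omega)) (ne_of_canon hco.2.1) (by decide)).1 hc
      rw [ub_of_match (tileCell_lt_ncells ψ hi1 hj (by omega)) (hnorth hcross 1 (by omega)), ub_colOut ψ xr d hi1 hj hne] at this
      rw [← hw] at this
      cases h' : ub ψ σ (tileCell ψ i j 0) pN4 <;> cases hx : w <;> simp_all
    -- the four inner chords
    have hch : ∀ r, 1 ≤ r → r ≤ 4 → Cond ψ σ (8 * (i * N ψ + j) + r) := fun r _ hr => hsat _ (tile_lt_ngadgets ψ hi hj (by omega))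
    have hs1 := gad_tile ψ hi hj (show 1 < 8 by omega); have hs2 := gad_tile ψ hi hj (show 2 < 8 by omega)
    have hs3 := gad_tile ψ hi hj (show 3 < 8 by omega); have hs4 := gad_tile ψ hi hj (show 4 < 8 by omega)
    unfold tileGad at hs1 hs2 hs3 hs4
    simp only [hcross, ↓reduceIte, show (1 : ℕ) ≠ 0 by decide, show (2 : ℕ) ≠ 0 by decide, show (2 : ℕ) ≠ 1 by decide,
      show (3 : ℕ) ≠ 0 by decide, show (3 : ℕ) ≠ 1 by decide, show (3 : ℕ) ≠ 2 by decide, show (4 : ℕ) ≠ 0 by decide,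
      show (4 : ℕ) ≠ 1 by decide, show (4 : ℕ) ≠ 2 by decide, show (4 : ℕ) ≠ 3 by decide] at hs1 hs2 hs3 hs4
    have e1 := (cond_xor_iff_ub hσ hs1 (hcells 0 (by omega)) (hcells 1 (by omega)) (tileCell_ne ψ hj (by omega) (by omega) (by omega))
      (by decide) (by decide)).1 (hch 1 le_rfl (by omega))
    have e2 := (cond_xor_iff_ub hσ hs2 (hcells 0 (by omega)) (hcells 1 (by omega)) (tileCell_ne ψ hj (by omega) (by omega) (by omega))
      (by decide) (by decide)).1 (hch 2 (by omega) (by omega))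
    have e3 := (cond_xor_iff_ub hσ hs3 (hcells 1 (by omega)) (hcells 2 (by omega)) (tileCell_ne ψ hj (by omega) (by omega) (by omega))
      (by decide) (by decide)).1 (hch 3 (by omega) (by omega))
    have e4 := (cond_xor_iff_ub hσ hs4 (hcells 0 (by omega)) (hcells 2 (by omega)) (tileCell_ne ψ hj (by omega) (by omega) (by omega))
      (by decide) (by decide)).1 (hch 4 (by omega) le_rfl)
    rw [rowInSlot, if_pos hcross] at hrin
    simp only [ub, ht0, ht1, ht2] at hrin hcin e1 e2 e3 e4
    have hv0 := extN_lt_ntrav hσ (hcells 0 (by omega)); have hv1 := extN_lt_ntrav hσ (hcells 1 (by omega))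
    have hv2 := extN_lt_ntrav hσ (hcells 2 (by omega))
    rw [ht0] at hv0; rw [ht1] at hv1; rw [ht2] at hv2
    obtain ⟨q0, q1, q2⟩ := cross_states_eq hv0 hv1 hv2 (xr i) w hrin hcin e1 e2 e3 e4
    intro c hc
    have hst := stateAt_tileCell ψ xr d hi hj hc
    rw [if_pos hcross] at hst
    rcases (show c = 0 ∨ c = 1 ∨ c = 2 by omega) with rfl | rfl | rfl
    · rw [hst, if_pos rfl]; exact q0
    · rw [hst, if_neg one_ne_zero, if_pos rfl]; exact q1
    · rw [hst, if_neg two_ne_zero, if_neg (by decide)]; exact q2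
  · -- a one-bit tile: the row bit propagates through the two inner chords
    have hty : ∀ c < 3, cellTyAt ψ (tileCell ψ i j c) = .bead := (cellTyAt_tileCell_cases ψ hi hj).2 hcross
    have hst : ∀ c < 3, stateAt ψ xr d (tileCell ψ i j c) = beadState (xr i) := fun c hc => by
      rw [stateAt_tileCell ψ xr d hi hj hc, if_neg hcross]
    obtain ⟨hb1, hb2, hb3, -⟩ := usesB_beadState (xr i)
    rw [rowInSlot, if_neg hcross] at hrin
    have m0 : extN σ (tileCell ψ i j 0) = (beadState (xr i)).val :=
      extN_eq_beadState hσ (hcells 0 (by omega)) (hty 0 (by omega)) (Or.inr (Or.inl rfl)) _ (by rw [hrin, hb2])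
    -- chord 1 : cell 0 . bN6  /  cell 1 . bN3
    have hs1 := gad_tile ψ hi hj (show 1 < 8 by omega); have hs2 := gad_tile ψ hi hj (show 2 < 8 by omega)
    unfold tileGad at hs1 hs2
    simp only [hcross, ↓reduceIte, show (1 : ℕ) ≠ 0 by decide, show (2 : ℕ) ≠ 0 by decide, show (2 : ℕ) ≠ 1 by decide] at hs1 hs2
    have e1 := (cond_xor_iff_ub hσ hs1 (hcells 0 (by omega)) (hcells 1 (by omega)) (tileCell_ne ψ hj (by omega) (by omega) (by omega))
      (by decide) (by decide)).1 (hsat _ (tile_lt_ngadgets ψ hi hj (show 1 < 8 by omega)))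
    have h06 : ub ψ σ (tileCell ψ i j 0) bN6 = !xr i := by
      rw [ub_of_match (hcells 0 (by omega)) (by rw [m0, hst 0 (by omega)]), (ports_bead_tile ψ xr d hi hj hcross).2.1]
    rw [h06] at e1
    have h13 : ub ψ σ (tileCell ψ i j 1) bN3 = xr i := by
      cases h' : ub ψ σ (tileCell ψ i j 1) bN3 <;> cases hx : xr i <;> simp_all
    have m1 : extN σ (tileCell ψ i j 1) = (beadState (xr i)).val :=
      extN_eq_beadState hσ (hcells 1 (by omega)) (hty 1 (by omega)) (Or.inr (Or.inl rfl)) _ (by rw [h13, hb2])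
    have e2 := (cond_xor_iff_ub hσ hs2 (hcells 1 (by omega)) (hcells 2 (by omega)) (tileCell_ne ψ hj (by omega) (by omega) (by omega))
      (by decide) (by decide)).1 (hsat _ (tile_lt_ngadgets ψ hi hj (show 2 < 8 by omega)))
    have h16 : ub ψ σ (tileCell ψ i j 1) bN6 = !xr i := by
      rw [ub_of_match (hcells 1 (by omega)) (by rw [m1, hst 1 (by omega)]), (ports_bead_tile ψ xr d hi hj hcross).2.2.2.1]
    rw [h16] at e2
    have h23 : ub ψ σ (tileCell ψ i j 2) bN3 = xr i := by
      cases h' : ub ψ σ (tileCell ψ i j 2) bN3 <;> cases hx : xr i <;> simp_all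
    have m2 : extN σ (tileCell ψ i j 2) = (beadState (xr i)).val :=
      extN_eq_beadState hσ (hcells 2 (by omega)) (hty 2 (by omega)) (Or.inr (Or.inl rfl)) _ (by rw [h23, hb2])
    intro c hc
    rcases (show c = 0 ∨ c = 1 ∨ c = 2 by omega) with rfl | rfl | rfl
    · rw [m0, hst 0 (by omega)]
    · rw [m1, hst 1 (by omega)]
    · rw [m2, hst 2 (by omega)]

/-- **All tiles of a solution match** (induction along the rows, tile by tile). [folklore] -/
theorem tileMatch_all {σ : Fin (cellsOf ψ).length → Fin 4} (hσ : ValidIdx (cellsOf ψ) σ) (hsat : ∀ g < ngadgets ψ, Cond ψ σ g)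
    (d : Bool) : ∀ i < V ψ, ∀ j < N ψ, TileMatch ψ σ (rowBits ψ σ) d i j := by
  suffices h : ∀ t i j, i < V ψ → j < N ψ → i * N ψ + j = t → TileMatch ψ σ (rowBits ψ σ) d i j from
    fun i hi j hj => h _ i j hi hj rfl
  intro t
  induction t using Nat.strong_induction_on with
  | _ t ih =>
    intro i j hi hj ht
    refine tileMatch_step hσ hsat hi hj (fun hjpos => ih (i * N ψ + (j - 1)) (by omega) i (j - 1) hi (by omega) rfl) fun hcross => ?_
    have hlt : rowOf ψ (varOf ψ j) < i := (tileTy_eq_cross_iff ψ).1 hcross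
    have : (i - 1) * N ψ + j < t := by
      have : (i - 1) * N ψ + N ψ = i * N ψ := by
        rw [show i = (i - 1) + 1 from (Nat.sub_add_cancel (show 1 ≤ i by omega)).symm]; simp [Nat.add_mul]
      omega
    exact ih _ this (i - 1) j (by omega) hj rfl

/-- **The clause-row terminals of a solution match.** [folklore] -/
theorem clauseBead_match {σ : Fin (cellsOf ψ).length → Fin 4} (hσ : ValidIdx (cellsOf ψ) σ) (hsat : ∀ g < ngadgets ψ, Cond ψ σ g)
    (d : Bool) {j : ℕ} (hj : j < N ψ) : extN σ (clauseBead ψ j) = (stateAt ψ (rowBits ψ σ) d (clauseBead ψ j)).val := by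
  set xr := rowBits ψ σ
  have hV : 0 < V ψ := V_pos_of_N_pos ψ (by omega)
  have hv := rowOf_varOf_lt ψ hj
  have hne : tileTy ψ (V ψ - 1) j ≠ .empty := tileTy_ne_empty_of_le ψ (by omega)
  have hco := colOutSlot_adj ψ (i := V ψ - 1) (by omega) hj hne
  have hls := landSlot_props ψ j
  have hs := gad_land ψ hj
  have hc := hsat _ (land_lt_ngadgets ψ hj)
  have := (cond_xor_iff_ub hσ hs (tileCell_lt_ncells ψ (by omega) hj (by omega)) (clauseBead_lt_ncells ψ hj)
    (tileCell_ne_clauseBead ψ (by omega) hj (by omega) j) (ne_of_canon hco.2.1) (ne_of_canon hls.2.1)).1 hc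
  rw [ub_of_match (tileCell_lt_ncells ψ (by omega) hj (by omega)) (tileMatch_all hσ hsat d _ (by omega) _ hj 1 (by omega)),
    ub_colOut ψ xr d (by omega) hj hne] at this
  have hland : ub ψ σ (clauseBead ψ j) (landSlot ψ j) = ub ψ (stateOf ψ xr d) (clauseBead ψ j) (landSlot ψ j) := by
    rw [(ub_land ψ xr d hj).1]
    cases h' : ub ψ σ (clauseBead ψ j) (landSlot ψ j) <;> cases hx : colBit ψ xr (V ψ - 1) j <;> simp_all
  rw [stateAt_clauseBead]
  refine extN_eq_beadState hσ (clauseBead_lt_ncells ψ hj) (cellTyAt_clauseBead ψ j) (e := landSlot ψ j) ?_ _ ?_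
  · unfold landSlot; split_ifs
    all_goals first | exact Or.inr (Or.inl rfl) | exact Or.inr (Or.inr (Or.inr (Or.inr rfl)))
  · rw [hland, ub_stateOf ψ xr d (clauseBead_lt_ncells ψ hj), cellTyAt_clauseBead, stateAt_clauseBead]

/-- **The doubling cell of a solution matches.** [folklore] -/
theorem zero_match {σ : Fin (cellsOf ψ).length → Fin 4} (hσ : ValidIdx (cellsOf ψ) σ) (xr : ℕ → Bool) :
    extN σ 0 = (stateAt ψ xr (dBit ψ σ) 0).val := by
  have h0 : 0 < ncells ψ := by unfold ncells; omega
  rw [stateAt_zero]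
  refine extN_eq_beadState hσ h0 (cellTyAt_zero ψ) (Or.inl rfl) _ ?_
  rw [(usesB_beadState _).1, dBit, ub, cellTyAt_zero]

/-- **Every solution is the intended vector of its row bits and doubling bit.** [folklore] -/
theorem eq_stateOf {σ : Fin (cellsOf ψ).length → Fin 4} (hσ : ValidIdx (cellsOf ψ) σ) (hsat : ∀ g < ngadgets ψ, Cond ψ σ g) :
    σ = stateOf ψ (rowBits ψ σ) (dBit ψ σ) := by
  funext ⟨k, hk⟩
  have hk' : k < ncells ψ := by rwa [length_cellsOf] at hk
  apply Fin.ext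
  show (σ ⟨k, hk⟩).val = (stateAt ψ (rowBits ψ σ) (dBit ψ σ) k).val
  rw [← extN_eq_val hk']
  rcases Nat.eq_zero_or_pos k with rfl | hpos
  · exact zero_match hσ _
  · by_cases hlt : k < 1 + 3 * (V ψ * N ψ)
    · have hN : 0 < N ψ := Nat.pos_of_ne_zero fun h => by rw [h] at hlt; simp at hlt; omega
      set t := (k - 1) / 3
      have ht : t < V ψ * N ψ := by omega
      have hi : t / N ψ < V ψ := (Nat.div_lt_iff_lt_mul hN).2 ht
      have hj : t % N ψ < N ψ := Nat.mod_lt _ hN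
      have hkc : k = tileCell ψ (t / N ψ) (t % N ψ) ((k - 1) % 3) := by
        have h1 := Nat.div_add_mod t (N ψ)
        have h2 : t / N ψ * N ψ = N ψ * (t / N ψ) := Nat.mul_comm _ _
        have h3 := Nat.div_add_mod (k - 1) 3
        unfold tileCell; omega
      rw [hkc]
      exact tileMatch_all hσ hsat _ _ hi _ hj _ (Nat.mod_lt _ (by omega))
    · have hkc : k = clauseBead ψ (k - (1 + 3 * (V ψ * N ψ))) := by unfold clauseBead; omega
      rw [hkc]
      exact clauseBead_match hσ hsat _ (by unfold ncells at hk'; omega)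

/-! ### Counting: solutions are (assignment, doubling bit) pairs -/

variable (ψ)

/-- **The row bits of an assignment of the variables.** [folklore] -/
def xrOf (a : ψ.vars → Bool) (i : ℕ) : Bool :=
  if h : i < V ψ then a ⟨(varRows ψ)[i], (mem_varRows_iff ψ).1 (List.getElem_mem h)⟩ else false

/-- **The assignment of the variables read off row bits.** [folklore] -/
def assignOf (xr : ℕ → Bool) : ψ.vars → Bool := fun y => xr (rowOf ψ y)

/-- Reading rows and then variables gives back the assignment. [folklore] -/
theorem assignOf_xrOf (a : ψ.vars → Bool) : assignOf ψ (xrOf ψ a) = a := by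
  funext ⟨y, hy⟩
  unfold assignOf xrOf
  rw [dif_pos (rowOf_lt ψ hy)]
  congr 1
  exact Subtype.ext (getElem_varRows_rowOf ψ hy)

/-- Reading variables and then rows gives back the row bits (below `V`). [folklore] -/
theorem xrOf_assignOf {xr : ℕ → Bool} {i : ℕ} (hi : i < V ψ) : xrOf ψ (assignOf ψ xr) i = xr i := by
  unfold xrOf assignOf
  rw [dif_pos hi, rowOf_getElem ψ hi]

/-- `stateOf` depends only on the row bits below `V`. [folklore] -/
theorem stateOf_congr {xr xr' : ℕ → Bool} (h : ∀ i < V ψ, xr i = xr' i) (d : Bool) : stateOf ψ xr d = stateOf ψ xr' d := by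
  funext ⟨k, hk⟩
  rw [length_cellsOf] at hk
  show stateAt ψ xr d k = stateAt ψ xr' d k
  have hcol : ∀ i j, j < N ψ → colBit ψ xr i j = colBit ψ xr' i j := fun i j hj => by
    unfold colBit; rw [h _ (rowOf_varOf_lt ψ hj)]
  have hlit : ∀ j, j < N ψ → litVal ψ xr j = litVal ψ xr' j := fun j hj => by
    unfold litVal; rw [h _ (rowOf_varOf_lt ψ hj)]
  rcases Nat.eq_zero_or_pos k with rfl | hpos
  · rw [stateAt_zero, stateAt_zero]
  · by_cases hlt : k < 1 + 3 * (V ψ * N ψ)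
    · have hN : 0 < N ψ := Nat.pos_of_ne_zero fun h => by rw [h] at hlt; simp at hlt; omega
      set t := (k - 1) / 3
      have ht : t < V ψ * N ψ := by omega
      have hi : t / N ψ < V ψ := (Nat.div_lt_iff_lt_mul hN).2 ht
      have hj : t % N ψ < N ψ := Nat.mod_lt _ hN
      have hkc : k = tileCell ψ (t / N ψ) (t % N ψ) ((k - 1) % 3) := by
        have h1 := Nat.div_add_mod t (N ψ)
        have h2 : t / N ψ * N ψ = N ψ * (t / N ψ) := Nat.mul_comm _ _
        have h3 := Nat.div_add_mod (k - 1) 3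
        unfold tileCell; omega
      rw [hkc, stateAt_tileCell ψ xr d hi hj (Nat.mod_lt _ (by omega)), stateAt_tileCell ψ xr' d hi hj (Nat.mod_lt _ (by omega)),
        h _ hi, hcol _ _ hj]
    · have hkc : k = clauseBead ψ (k - (1 + 3 * (V ψ * N ψ))) := by unfold clauseBead; omega
      have hj : k - (1 + 3 * (V ψ * N ψ)) < N ψ := by unfold ncells at hk; omega
      rw [hkc, stateAt_clauseBead, stateAt_clauseBead, hlit _ hj]

/-- If there is a row then there is a column. [folklore] -/
theorem N_pos_of_V_pos (h : 0 < V ψ) : 0 < N ψ := by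
  have hmem : (varRows ψ)[0] ∈ ψ.vars := (mem_varRows_iff ψ).1 (List.getElem_mem h)
  rw [CNF.vars, List.mem_toFinset, List.mem_map] at hmem
  obtain ⟨l, hl, -⟩ := hmem
  exact List.length_pos_of_mem (show l ∈ cols ψ from hl)

/-- **Reading back the row bits of an intended vector.** [folklore] -/
theorem rowBits_stateOf (xr : ℕ → Bool) (d : Bool) {i : ℕ} (hi : i < V ψ) : rowBits ψ (stateOf ψ xr d) i = xr i :=
  ub_rowIn ψ xr d hi (N_pos_of_V_pos ψ (by omega))

/-- **Reading back the doubling bit of an intended vector.** [folklore] -/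
theorem dBit_stateOf (xr : ℕ → Bool) (d : Bool) : dBit ψ (stateOf ψ xr d) = d := by
  rw [dBit, ub_stateOf ψ xr d (by unfold ncells; omega), cellTyAt_zero, stateAt_zero, (usesB_beadState d).1]

/-- The formula under the assignment reading the rows is the formula under the extended assignment
of the variables. [folklore] -/
theorem eval_rows_eq (xr : ℕ → Bool) : ψ.eval (fun y => xr (rowOf ψ y)) = ψ.eval (ψ.extendAssignment (assignOf ψ xr)) :=
  (ψ.eval_extendAssignment_restrict fun y => xr (rowOf ψ y)).symm

/-- **The solution map** `(a, d) ↦ stateOf (rows of a) d`. [folklore] -/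
def solOf (p : (ψ.vars → Bool) × Bool) : Fin (cellsOf ψ).length → Fin 4 := stateOf ψ (xrOf ψ p.1) p.2

/-- The solution map is injective. [folklore] -/
theorem solOf_injective : Function.Injective (solOf ψ) := by
  rintro ⟨a, d⟩ ⟨a', d'⟩ h
  simp only [solOf] at h
  have hd : d = d' := by rw [← dBit_stateOf ψ (xrOf ψ a) d, h, dBit_stateOf]
  have ha : ∀ i < V ψ, xrOf ψ a i = xrOf ψ a' i := fun i hi => by
    rw [← rowBits_stateOf ψ (xrOf ψ a) d hi, h, rowBits_stateOf ψ _ _ hi]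
  subst hd
  simp only [Prod.mk.injEq, and_true]
  rw [← assignOf_xrOf ψ a, ← assignOf_xrOf ψ a']
  funext ⟨y, hy⟩
  exact ha _ (rowOf_lt ψ hy)

/-- **The number of solutions of the constraint system is `2 · #SAT(ψ)`** (clauses of width one or
three). [folklore] -/
theorem card_solutions_eq (hw : ∀ q (hq : q < ψ.length), ψ[q].length = 1 ∨ ψ[q].length = 3) :
    (univ.filter fun σ : Fin (cellsOf ψ).length → Fin 4 => ValidIdx (cellsOf ψ) σ ∧ ∀ g < ngadgets ψ, Cond ψ σ g).card =
      2 * ψ.numSat := by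
  classical
  set A : Finset ((ψ.vars → Bool) × Bool) := (univ.filter fun a : ψ.vars → Bool => ψ.eval (ψ.extendAssignment a) = true) ×ˢ univ
    with hA
  have hcardA : A.card = 2 * ψ.numSat := by
    rw [hA, card_product, card_univ, Fintype.card_bool, CNF.numSat, Nat.mul_comm]
  have hset : (univ.filter fun σ : Fin (cellsOf ψ).length → Fin 4 => ValidIdx (cellsOf ψ) σ ∧ ∀ g < ngadgets ψ, Cond ψ σ g) =
      A.image (solOf ψ) := by
    ext σ
    simp only [mem_filter, mem_univ, true_and, mem_image, mem_product, and_true, hA, Prod.exists, solOf]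
    constructor
    · rintro ⟨hσ, hsat⟩
      refine ⟨assignOf ψ (rowBits ψ σ), dBit ψ σ, ?_, ?_⟩
      · have h := (forall_cond_stateOf_iff ψ (rowBits ψ σ) (dBit ψ σ) hw).1 (by rw [← eq_stateOf hσ hsat]; exact hsat)
        rwa [eval_rows_eq] at h
      · rw [stateOf_congr ψ (fun i hi => xrOf_assignOf ψ hi), ← eq_stateOf hσ hsat]
    · rintro ⟨a, d, ha, rfl⟩
      refine ⟨validIdx_stateOf ψ _ _, (forall_cond_stateOf_iff ψ (xrOf ψ a) d hw).2 ?_⟩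
      rw [eval_rows_eq, assignOf_xrOf]
      exact ha
  rw [hset, card_image_of_injective A (solOf_injective ψ), hcardA]

/-- **The graph of a formula with clauses of width one or three has `2 · #SAT` Hamiltonian paths**
from `conn 0` to `lastQ`. [cite: LiskiewiczOgiharaToda2003, §3 (proof of Lemma 4: "each Hamiltonian path of G corresponds to a satisfying assignment")] -/
theorem hamCount_graphOf_eq_two_mul_numSat (hw : ∀ q (hq : q < ψ.length), ψ[q].length = 1 ∨ ψ[q].length = 3) :
    hamCount (graphOf ψ) (vertsOf ψ) (conn 0) (lastQ (cellsOf ψ)) = 2 * ψ.numSat := by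
  rw [hamCount_graphOf_eq_card, ← card_solutions_eq ψ hw]
  simp only [Cond]
end GridFormula

end Literature.Combinatorics.SimpleGraph
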